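import Mathlib
import Summits.ValiantsHypothesis.ValiantsHypothesis.Theorems.KPlusLogSqLawWeakLiftingTowerGraftSignedCrossingPencilSignature

/-!
# Tower graft line — SIGNED CROSSINGS XIV: WHERE THE UNPAID ROOTS LIVE — the cancellation law at co-Euler-positive roots of a
# semidefinite graft (S4's object)

Structure file for LINE (B) `Cruxes/WeakLifting/Lines/tower_graft.lean` (crux `WeakLifting` = stmt-ValiantsHypothesis-19561),
fourteenth (last) of the SIGNED-CROSSING series.  By files V/X/XI the roots of a one-letter graft `F = G + u^D S` split into co-Euler-NEGATIVE
ones (paid by the inertia flux, at most `m` net) and co-Euler-POSITIVE ones (the unpaid mass `N₊`; `#roots = 2N₊ + const` generically).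
This file says WHERE a co-Euler-positive root can be when the far letter is positive semidefinite (S4: `S ⪰ 0`, e.g. the identity graft):
on its kernel vector `v` the letter forms `q_l = vᵀS_l v` of the CLASS pencil `G` CANCEL at `t` to within the ratio `max_l d_l / D`
(`< 1/m` on a tower) — the elementary, kernel-vector form of the memo's «log-slope-`D` points live near events» (tower_graft-S5.md §1, T1).

§1 `kernel_form_eq` — at a root, `vᵀG(t)v = −t^D·vᵀSv` (so `≤ 0` when `S ⪰ 0`).
§2 ★★ `cancellation_of_coEulerPos` — `F(t)v = 0`, `t > 0`, `S ⪰ 0`, `vᵀ(Σ_l (D − d_l)t^{d_l}S_l)v > 0` ⇒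
   `D · |Σ_l t^{d_l} q_l| < Σ_l d_l t^{d_l} |q_l|` and hence `D · |Σ_l t^{d_l} q_l| < (max d) · Σ_l t^{d_l} |q_l|` in the form
   `D · |vᵀG(t)v| < d⋆ · Σ_l t^{d_l}|vᵀS_l v|` for any common bound `d_l ≤ d⋆`: the signed sum of the letter forms along the kernel vector is
   smaller than the unsigned sum by the factor `d⋆/D`.
§3 `cancellation_of_coEulerNeg_negSemidef` — the mirror for `S ⪯ 0` at co-Euler-NEGATIVE roots.
READING FOR THE LINE (honest): for S4 (semidefinite far letter) every root NOT paid by the flux carries a kernel vector along which the class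
pencil's quadratic form nearly vanishes (relative cancellation `< max d / D < 1/m` on towers) — a NEAR-EVENT of the class in the direction `v`.
Turning «near-event directions» into a class-currency COUNT is T1/T2 of the memo and is NOT done here.  Zero stub credit; S4/S5, TowerB,
WeakLifting, Conjecture B, 18050, VP ≠ VNP untouched.  Def-free; Mathlib + files I–XIII.  Seat: prover val-sym-lift-p2 g24,
`--supports stmt-ValiantsHypothesis-19561 --as helper`.  [this work; elementary]
-/

-- `Summit.ValiantsHypothesis.ValiantsHypothesis.…` repeats a component by the D-0017 layout
-- (single-conjunct summit), which the `dupNamespace` linter flags; the name is mandated.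
set_option linter.dupNamespace false
set_option autoImplicit false

namespace Summit.ValiantsHypothesis.ValiantsHypothesis.Theorems.KPlusLogSqLaw.TowerGraft

open Matrix Finset
open scoped BigOperators
open Summit.ValiantsHypothesis.ValiantsHypothesis.Theorems.KPlusLogSqLaw (MonotoneInertia.dotProduct_sum_smul_mulVec)

namespace SignedCrossing

variable {m K : ℕ}

/-! ## §1 The kernel identity -/

/-- at a root of the graft, the class form and the far-letter form cancel on the kernel vector: `vᵀG(t)v = −t^D · vᵀSv`. [folklore] -/
theorem kernel_form_eq (D : ℕ) (d : Fin K → ℕ) (S : Fin K → Matrix (Fin m) (Fin m) ℝ) (Sfar : Matrix (Fin m) (Fin m) ℝ) {t : ℝ}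
    {v : Fin m → ℝ} (hv : ((∑ l, (t ^ d l) • S l) + (t ^ D) • Sfar) *ᵥ v = 0) :
    v ⬝ᵥ (∑ l, (t ^ d l) • S l) *ᵥ v = -(t ^ D * (v ⬝ᵥ Sfar *ᵥ v)) := by
  have h : v ⬝ᵥ ((∑ l, (t ^ d l) • S l) + (t ^ D) • Sfar) *ᵥ v = 0 := by rw [hv, dotProduct_zero]
  rw [Matrix.add_mulVec, dotProduct_add, Matrix.smul_mulVec, dotProduct_smul, smul_eq_mul] at h
  linarith

/-! ## §2 The cancellation law at co-Euler-positive roots (`S ⪰ 0`) -/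

/-- **CANCELLATION AT CO-EULER-POSITIVE ROOTS (semidefinite far letter).**  `F = Σ_l u^{d_l}S_l + u^D S` with `S ⪰ 0`, a root `t > 0` with
kernel vector `v` (`F(t)v = 0`) on which the co-Euler base is positive, `vᵀ(Σ_l (D − d_l)t^{d_l}S_l)v > 0` (`d_l ≤ D`).  Then, with `q_l = vᵀS_l v`:
`D · |Σ_l t^{d_l} q_l| < Σ_l d_l t^{d_l} |q_l|` — the letter forms cancel along `v` at `t`. [this work] -/
theorem cancellation_of_coEulerPos (D : ℕ) (d : Fin K → ℕ) (hdD : ∀ l, d l ≤ D) (S : Fin K → Matrix (Fin m) (Fin m) ℝ)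
    (Sfar : Matrix (Fin m) (Fin m) ℝ) (hSfar : Sfar.PosSemidef) {t : ℝ} (ht : 0 < t) {v : Fin m → ℝ}
    (hv : ((∑ l, (t ^ d l) • S l) + (t ^ D) • Sfar) *ᵥ v = 0)
    (hpos : 0 < v ⬝ᵥ (∑ l, (((D - d l : ℕ) : ℝ) * t ^ d l) • S l) *ᵥ v) :
    (D : ℝ) * |∑ l, t ^ d l * (v ⬝ᵥ S l *ᵥ v)| < ∑ l, (d l : ℝ) * t ^ d l * |v ⬝ᵥ S l *ᵥ v| := by
  -- the class form on the kernel vector is `≤ 0`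
  have hG : v ⬝ᵥ (∑ l, (t ^ d l) • S l) *ᵥ v = ∑ l, t ^ d l * (v ⬝ᵥ S l *ᵥ v) := MonotoneInertia.dotProduct_sum_smul_mulVec S _ v
  have hS0 : 0 ≤ v ⬝ᵥ Sfar *ᵥ v := by simpa using hSfar.dotProduct_mulVec_nonneg v
  have hle : ∑ l, t ^ d l * (v ⬝ᵥ S l *ᵥ v) ≤ 0 := by
    rw [← hG, kernel_form_eq D d S Sfar hv]
    have : 0 ≤ t ^ D * (v ⬝ᵥ Sfar *ᵥ v) := mul_nonneg (pow_nonneg ht.le _) hS0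
    linarith
  -- the co-Euler form: `Σ (D - d_l) t^{d_l} q_l > 0`, i.e. `D·Σ t^{d_l} q_l > Σ d_l t^{d_l} q_l`
  rw [MonotoneInertia.dotProduct_sum_smul_mulVec] at hpos
  have hsplit : ∑ l, ((D - d l : ℕ) : ℝ) * t ^ d l * (v ⬝ᵥ S l *ᵥ v) =
      (D : ℝ) * ∑ l, t ^ d l * (v ⬝ᵥ S l *ᵥ v) - ∑ l, (d l : ℝ) * t ^ d l * (v ⬝ᵥ S l *ᵥ v) := by
    rw [Finset.mul_sum, ← Finset.sum_sub_distrib]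
    refine Finset.sum_congr rfl fun l _ => ?_
    rw [Nat.cast_sub (hdD l)]
    ring
  rw [hsplit] at hpos
  -- `Σ d_l t^{d_l} q_l < D·Σ t^{d_l} q_l ≤ 0`, so `D·|Σ t^{d_l} q_l| = -D Σ… < -Σ d_l t^{d_l} q_l ≤ Σ d_l t^{d_l} |q_l|`
  rw [abs_of_nonpos hle, mul_neg]
  have hbound : -(∑ l, (d l : ℝ) * t ^ d l * (v ⬝ᵥ S l *ᵥ v)) ≤ ∑ l, (d l : ℝ) * t ^ d l * |v ⬝ᵥ S l *ᵥ v| := by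
    rw [← Finset.sum_neg_distrib]
    refine Finset.sum_le_sum fun l _ => ?_
    have h1 : 0 ≤ (d l : ℝ) * t ^ d l := by positivity
    have h2 : -(v ⬝ᵥ S l *ᵥ v) ≤ |v ⬝ᵥ S l *ᵥ v| := neg_le_abs _
    nlinarith
  linarith

/-- **the cancellation ratio**: under the same hypotheses and a common exponent bound `d_l ≤ d⋆`,
`D · |vᵀG(t)v| < d⋆ · Σ_l t^{d_l} |vᵀS_l v|` — the signed sum of the letter forms along the kernel vector is below the unsigned sum by the
factor `d⋆/D` (`< 1/m` on an `m`-tower with `d⋆ = max d`). [this work] -/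
theorem cancellation_ratio_of_coEulerPos (D : ℕ) (d : Fin K → ℕ) (hdD : ∀ l, d l ≤ D) (dstar : ℕ) (hdstar : ∀ l, d l ≤ dstar)
    (S : Fin K → Matrix (Fin m) (Fin m) ℝ) (Sfar : Matrix (Fin m) (Fin m) ℝ) (hSfar : Sfar.PosSemidef) {t : ℝ} (ht : 0 < t)
    {v : Fin m → ℝ} (hv : ((∑ l, (t ^ d l) • S l) + (t ^ D) • Sfar) *ᵥ v = 0)
    (hpos : 0 < v ⬝ᵥ (∑ l, (((D - d l : ℕ) : ℝ) * t ^ d l) • S l) *ᵥ v) :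
    (D : ℝ) * |v ⬝ᵥ (∑ l, (t ^ d l) • S l) *ᵥ v| < (dstar : ℝ) * ∑ l, t ^ d l * |v ⬝ᵥ S l *ᵥ v| := by
  have h := cancellation_of_coEulerPos D d hdD S Sfar hSfar ht hv hpos
  rw [MonotoneInertia.dotProduct_sum_smul_mulVec]
  refine h.trans_le ?_
  rw [Finset.mul_sum]
  refine Finset.sum_le_sum fun l _ => ?_
  have h1 : 0 ≤ t ^ d l * |v ⬝ᵥ S l *ᵥ v| := by positivity
  have h2 : (d l : ℝ) ≤ dstar := by exact_mod_cast hdstar l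
  nlinarith

/-! ## §3 The mirror: `S ⪯ 0`, co-Euler-negative roots -/

/-- **mirror law**: `F = G + u^D S` with `−S ⪰ 0`, a root `t > 0` with kernel vector `v` on which the co-Euler base is NEGATIVE ⇒ the same
cancellation `D · |Σ_l t^{d_l} q_l| < Σ_l d_l t^{d_l} |q_l|` (apply §2 to the letters `−S_l`, `−S`). [this work] -/
theorem cancellation_of_coEulerNeg_negSemidef (D : ℕ) (d : Fin K → ℕ) (hdD : ∀ l, d l ≤ D) (S : Fin K → Matrix (Fin m) (Fin m) ℝ)
    (Sfar : Matrix (Fin m) (Fin m) ℝ) (hSfar : (-Sfar).PosSemidef) {t : ℝ} (ht : 0 < t) {v : Fin m → ℝ}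
    (hv : ((∑ l, (t ^ d l) • S l) + (t ^ D) • Sfar) *ᵥ v = 0)
    (hneg : v ⬝ᵥ (∑ l, (((D - d l : ℕ) : ℝ) * t ^ d l) • S l) *ᵥ v < 0) :
    (D : ℝ) * |∑ l, t ^ d l * (v ⬝ᵥ S l *ᵥ v)| < ∑ l, (d l : ℝ) * t ^ d l * |v ⬝ᵥ S l *ᵥ v| := by
  -- negate everything
  have hv' : ((∑ l, (t ^ d l) • (-S l)) + (t ^ D) • (-Sfar)) *ᵥ v = 0 := by
    have h : (∑ l, (t ^ d l) • (-S l)) + (t ^ D) • (-Sfar) = -((∑ l, (t ^ d l) • S l) + (t ^ D) • Sfar) := by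
      rw [neg_add, smul_neg, ← Finset.sum_neg_distrib]
      congr 1
      exact Finset.sum_congr rfl fun l _ => smul_neg _ _
    rw [h, Matrix.neg_mulVec, hv, neg_zero]
  have hpos' : 0 < v ⬝ᵥ (∑ l, (((D - d l : ℕ) : ℝ) * t ^ d l) • (-S l)) *ᵥ v := by
    rw [MonotoneInertia.dotProduct_sum_smul_mulVec] at hneg ⊢
    rw [← neg_pos, ← Finset.sum_neg_distrib] at hneg
    refine hneg.trans_eq (Finset.sum_congr rfl fun l _ => ?_)
    rw [Matrix.neg_mulVec, dotProduct_neg]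
    ring
  have h := cancellation_of_coEulerPos D d hdD (fun l => -S l) (-Sfar) hSfar ht hv' hpos'
  have habs : ∀ l, |v ⬝ᵥ (-S l) *ᵥ v| = |v ⬝ᵥ S l *ᵥ v| := fun l => by rw [Matrix.neg_mulVec, dotProduct_neg, abs_neg]
  have hsum : ∑ l, t ^ d l * (v ⬝ᵥ (-S l) *ᵥ v) = -∑ l, t ^ d l * (v ⬝ᵥ S l *ᵥ v) := by
    rw [← Finset.sum_neg_distrib]
    exact Finset.sum_congr rfl fun l _ => by rw [Matrix.neg_mulVec, dotProduct_neg]; ring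
  simp only [habs, hsum, abs_neg] at h
  exact h

end SignedCrossing

end Summit.ValiantsHypothesis.ValiantsHypothesis.Theorems.KPlusLogSqLaw.TowerGraft
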